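import Summits.AnomalousDissipation.AnomalousDissipation.Theorems.FloorCertificateEnsembleCeiling.Negative.KillShapes
import Summits.AnomalousDissipation.AnomalousDissipation.Theorems.EnsembleCeiling.Negative.BeltramiFat
import Literature.Analysis.FunctionSpaces.TorusFluidGlueProofs

/-!
# `TaylorCertificates.FloorCertificateEnsembleCeiling` (stmt-AnomalousDissipation-14086) — negative side VIII:
# the laminar fat branch of an Euler-steady Laplacian preimage (abstract Marchioro barrier)

cdisprove seat `refuter-cdisprove-stmt-AnomalousDissipation-14086-g3-0` (generation 3, 2026-08-16).

The landed witness exclusions of the ceiling half (`EnsembleCeiling/Negative/{BeltramiFat, OrthogonalClassFat,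
CellularFat, SingleModeFat}`) all run ONE mechanism on explicit trigonometric polynomials: the Stokes preimage of the
force is a steady Euler flow, so `u = A⁻¹f/ν` is an exact steady state of `NS_ν(f)` of energy `≍ ν⁻²` — a FAT Dirac
statistics. This file states the mechanism ONCE, abstractly, for an arbitrary smooth profile:

* `exists_fat_steady_of_eulerSteady_laplacianPreimage` — if `U` is smooth, solenoidal, mean-zero and weakly
  Euler-steady (`∫ (U ⊗ U) : ∇w = 0` for every test field `w`), then for the force `f = −ΔU` and every `ν > 0` the
  state `U/ν` is a steady weak solution of `NS_ν(f)` in `V` with `|U/ν|² = ‖U‖₂²/ν²`;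
* `xBody_false_of_eulerSteady_laplacianPreimage` — hence, if `U ≠ 0` in `L²`, the `∀ ν`-body of
  `X = FloorCertificateEnsembleCeiling` is FALSE at `f = −ΔU` (`KillShapes.xAt_false_of_fat_steady_family`);
* `target_witness_not_laplacian_of_eulerSteady` — read on `X`: its witness force is not `−ΔU` for any non-trivial
  smooth weakly Euler-steady solenoidal mean-zero `U`.

Scope gained over the trig-polynomial files: every smooth unidirectional profile `U = G(x₁,x₂) e₃` (so every smooth
force `g(x₁,x₂) e₃`, `g = −ΔG`, not only finitely many modes), every smooth 2-D steady Euler flow lifted to `T³`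
(`U = (∇⊥ψ, 0)`, `Δψ = F(ψ)`, single-shell or not), every smooth Beltrami-type or other steady Euler field — in each
case `f = −ΔU` inherits NO floor-and-ceiling pair. (Instantiating the hypothesis for those families is left to the
files that need them; the three trig-polynomial exclusions remain the kernel-checked instances.) Def-free; nothing
here asserts a Theses statement.
-/

noncomputable section

set_option linter.dupNamespace false

open MeasureTheory UnitAddTorus Filter Topology
open scoped InnerProductSpace ENNReal

namespace Summit.AnomalousDissipation.AnomalousDissipation.Theorems.FloorCertificateEnsembleCeiling.Negative

open Literature.Analysis.FunctionSpaces Literature.Analysis.FluidPDE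
open Summit.AnomalousDissipation.AnomalousDissipation.Theses.TaylorCertificates
open Summit.AnomalousDissipation.AnomalousDissipation.Theorems.TaylorCertificatePair.Negative
open Summit.AnomalousDissipation.AnomalousDissipation.Theorems.EnsembleCeiling.Negative

/-- **The laminar branch of an Euler-steady Laplacian preimage.** Let `U` be smooth, solenoidal, mean-zero and
weakly Euler-steady. Then for every `ν > 0` the force `f = −ΔU` has the steady weak solution `U/ν ∈ V` of
`NS_ν(f)`, of energy `‖U‖₂²/ν²`: `⟨F_ν(U/ν), w⟩ = −(ΔU, w) + ν (U/ν, Δw) + ν⁻² ∫ (U⊗U):∇w = 0` by Green's identity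
and Euler-steadiness. -/
theorem exists_fat_steady_of_eulerSteady_laplacianPreimage {U : UnitAddTorus (Fin 3) → EuclideanSpace ℝ (Fin 3)}
    (hUs : Torus.IsSmooth U) (hUd : Torus.IsDivFree U) (hUz : Torus.HasZeroMean U)
    (hI : ∀ w : UnitAddTorus (Fin 3) → EuclideanSpace ℝ (Fin 3), Torus.IsSmooth w → Torus.IsDivFree w →
      Torus.HasZeroMean w → ∫ x, ⟪Torus.fderiv w x (U x), U x⟫_ℝ = 0)
    {ν : ℝ} (hν : 0 < ν) :
    ∃ u : Torus.energySpace (Fin 3),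
      (u : Lp (EuclideanSpace ℝ (Fin 3)) 2 (volume : Measure (UnitAddTorus (Fin 3)))) ∈ Torus.energySpaceV (Fin 3) ∧
      Torus.IsSteadyWeakSolution ν (fun x => -Torus.laplacian U x) u ∧
      ‖u‖ ^ 2 = (∫ x, ‖U x‖ ^ 2) / ν ^ 2 := by
  set c : ℝ := ν⁻¹ with hc
  set uf : UnitAddTorus (Fin 3) → EuclideanSpace ℝ (Fin 3) := fun x => c • U x with huf
  have huf' : uf = fun y => ∑ i ∈ ({0} : Finset ℕ), (fun _ : ℕ => c) i • (fun _ : ℕ => U) i y := by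
    funext y
    simp [huf]
  have hsm : Torus.IsSmooth uf := hUs.smul c
  have hdf : Torus.IsDivFree uf := by
    rw [huf']
    exact Torus.IsDivFree.sum_smul _ _ (fun _ => hUs) (fun _ => hUd)
  have hzm : Torus.HasZeroMean uf := by
    rw [huf']
    exact Torus.HasZeroMean.sum_smul _ _ (fun _ => hUs.integrable) (fun _ => hUz)
  have hmem : MemLp uf 2 volume := hsm.memLp 2
  obtain ⟨u, hu⟩ : ∃ u : Torus.energySpace (Fin 3),
      ((u : Lp (EuclideanSpace ℝ (Fin 3)) 2 (volume : Measure (UnitAddTorus (Fin 3)))) :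
        UnitAddTorus (Fin 3) → EuclideanSpace ℝ (Fin 3)) =ᵐ[volume] uf :=
    ⟨⟨hmem.toLp uf, Torus.smoothSolenoidal_subset_energySpace ⟨uf, hsm, hdf, hzm, hmem.coeFn_toLp⟩⟩, hmem.coeFn_toLp⟩
  have hV : (u : Lp (EuclideanSpace ℝ (Fin 3)) 2 (volume : Measure (UnitAddTorus (Fin 3)))) ∈ Torus.energySpaceV (Fin 3) :=
    Torus.smoothSolenoidal_subset_energySpaceV_holds ⟨uf, hsm, hdf, hzm, hu⟩
  refine ⟨u, hV, ?_, ?_⟩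
  · intro w hw hdw hzw
    rw [nsGeneratorPairing_of_ae hu, huf, integral_inertial_const_smul, hI w hw hdw hzw, mul_zero, add_zero,
      integral_inner_const_smul_left]
    have hG : ∫ x, ⟪U x, Torus.laplacian w x⟫_ℝ = ∫ x, ⟪Torus.laplacian U x, w x⟫_ℝ :=
      (Torus.integral_inner_laplacian_comm hUs hw).symm
    have hneg : (∫ x, ⟪-Torus.laplacian U x, w x⟫_ℝ) = -∫ x, ⟪Torus.laplacian U x, w x⟫_ℝ := by
      rw [← integral_neg]
      exact integral_congr_ae (ae_of_all _ fun x => inner_neg_left _ _)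
    rw [hG, hneg, hc]
    field_simp
    ring
  · rw [norm_sq_of_ae hu, huf, integral_norm_sq_const_smul, hc]
    field_simp

/-- **No floor-and-ceiling pair at the Laplacian of a non-trivial Euler-steady profile** (the `∀ ν`-body of
`X` at `f = −ΔU` is false): the laminar states `U/ν` are a FAT steady family
(`xAt_false_of_fat_steady_family`). -/
theorem xBody_false_of_eulerSteady_laplacianPreimage {U : UnitAddTorus (Fin 3) → EuclideanSpace ℝ (Fin 3)}
    (hUs : Torus.IsSmooth U) (hUd : Torus.IsDivFree U) (hUz : Torus.HasZeroMean U)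
    (hI : ∀ w : UnitAddTorus (Fin 3) → EuclideanSpace ℝ (Fin 3), Torus.IsSmooth w → Torus.IsDivFree w →
      Torus.HasZeroMean w → ∫ x, ⟪Torus.fderiv w x (U x), U x⟫_ℝ = 0)
    (hU0 : 0 < ∫ x, ‖U x‖ ^ 2) :
    ¬ ∃ (ε₀ E ν₀ : ℝ), 0 < ε₀ ∧ 0 < ν₀ ∧ ∀ ν : ℝ, 0 < ν → ν < ν₀ →
      (∃ (Φ₁ : Torus.CylindricalTest (Fin 3)) (θ₁ : ℝ), θ₁ ≤ 0 ∧ ∀ u : Torus.energySpace (Fin 3),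
        Torus.eGradNormSq ((u : Lp (EuclideanSpace ℝ (Fin 3)) 2 (volume : Measure (UnitAddTorus (Fin 3)))) : UnitAddTorus (Fin 3) → EuclideanSpace ℝ (Fin 3)) ≠ ⊤ →
        ‖u‖ ^ 2 ≤ 16 * (∫ x, ‖(fun x => -Torus.laplacian U x) x‖ ^ 2) / ν ^ 2 →
        ε₀ ≤ ν * (Torus.eGradNormSq ((u : Lp (EuclideanSpace ℝ (Fin 3)) 2 (volume : Measure (UnitAddTorus (Fin 3)))) : UnitAddTorus (Fin 3) → EuclideanSpace ℝ (Fin 3))).toReal +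
          Torus.nsGeneratorPairing ν (fun x => -Torus.laplacian U x) u (Φ₁.grad u) +
          2 * θ₁ * (Torus.pairing (u : Lp (EuclideanSpace ℝ (Fin 3)) 2 (volume : Measure (UnitAddTorus (Fin 3)))) (fun x => -Torus.laplacian U x) -
            ν * (Torus.eGradNormSq ((u : Lp (EuclideanSpace ℝ (Fin 3)) 2 (volume : Measure (UnitAddTorus (Fin 3)))) : UnitAddTorus (Fin 3) → EuclideanSpace ℝ (Fin 3))).toReal)) ∧
      (∀ μ : Measure (Torus.energySpace (Fin 3)), Torus.IsStationaryStatisticalSolution ν (fun x => -Torus.laplacian U x) μ →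
        Integrable (fun v : Torus.energySpace (Fin 3) => ‖v‖ ^ 2) μ → Torus.ensembleEnergy μ ≤ E) := by
  have hf : MemLp (fun x => -Torus.laplacian U x) 2 volume := (hUs.laplacian.memLp 2).neg
  refine xAt_false_of_fat_steady_family hf fun E ν₀ hν₀ => ?_
  set A : ℝ := ∫ x, ‖U x‖ ^ 2 with hA
  have hE1 : 0 < |E| + 1 := by positivity
  set ν : ℝ := min (ν₀ / 2) (min 1 (A / (|E| + 1))) with hνdef
  have hν : 0 < ν := lt_min (half_pos hν₀) (lt_min one_pos (div_pos hU0 hE1))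
  have hνν₀ : ν < ν₀ := (min_le_left _ _).trans_lt (half_lt_self hν₀)
  have hν1 : ν ≤ 1 := (min_le_right _ _).trans (min_le_left _ _)
  have hνA : ν ≤ A / (|E| + 1) := (min_le_right _ _).trans (min_le_right _ _)
  obtain ⟨u, hV, hu, hen⟩ := exists_fat_steady_of_eulerSteady_laplacianPreimage hUs hUd hUz hI hν
  refine ⟨ν, hν, hνν₀, u, hV, hu, ?_⟩
  rw [hen, lt_div_iff₀ (by positivity)]
  have h1 : E * ν ^ 2 ≤ |E| * ν := by
    calc E * ν ^ 2 ≤ |E| * ν ^ 2 := mul_le_mul_of_nonneg_right (le_abs_self E) (sq_nonneg ν)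
      _ ≤ |E| * ν := mul_le_mul_of_nonneg_left (by nlinarith) (abs_nonneg E)
  have h2 : |E| * ν ≤ |E| * (A / (|E| + 1)) := mul_le_mul_of_nonneg_left hνA (abs_nonneg E)
  have h3 : |E| * (A / (|E| + 1)) < A := by
    rw [mul_div_assoc', div_lt_iff₀ hE1]
    nlinarith
  linarith

/-- **`X`'s witness is not the Laplacian of an Euler-steady profile**: if `FloorCertificateEnsembleCeiling` holds
with witness force `f`, then `f` is not (pointwise) `−ΔU` for any smooth solenoidal mean-zero weakly Euler-steady
`U` with `‖U‖₂ > 0` (ABC/Beltrami, single-shell Euler-steady, unidirectional, planar cellular, lifted 2-D steady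
Euler, … profiles are all excluded at once). -/
theorem target_witness_not_laplacian_of_eulerSteady {f : UnitAddTorus (Fin 3) → EuclideanSpace ℝ (Fin 3)}
    (hX : ∃ (ε₀ E ν₀ : ℝ), 0 < ε₀ ∧ 0 < ν₀ ∧ ∀ ν : ℝ, 0 < ν → ν < ν₀ →
      (∃ (Φ₁ : Torus.CylindricalTest (Fin 3)) (θ₁ : ℝ), θ₁ ≤ 0 ∧ ∀ u : Torus.energySpace (Fin 3),
        Torus.eGradNormSq ((u : Lp (EuclideanSpace ℝ (Fin 3)) 2 (volume : Measure (UnitAddTorus (Fin 3)))) : UnitAddTorus (Fin 3) → EuclideanSpace ℝ (Fin 3)) ≠ ⊤ →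
        ‖u‖ ^ 2 ≤ 16 * (∫ x, ‖f x‖ ^ 2) / ν ^ 2 →
        ε₀ ≤ ν * (Torus.eGradNormSq ((u : Lp (EuclideanSpace ℝ (Fin 3)) 2 (volume : Measure (UnitAddTorus (Fin 3)))) : UnitAddTorus (Fin 3) → EuclideanSpace ℝ (Fin 3))).toReal +
          Torus.nsGeneratorPairing ν f u (Φ₁.grad u) +
          2 * θ₁ * (Torus.pairing (u : Lp (EuclideanSpace ℝ (Fin 3)) 2 (volume : Measure (UnitAddTorus (Fin 3)))) f -
            ν * (Torus.eGradNormSq ((u : Lp (EuclideanSpace ℝ (Fin 3)) 2 (volume : Measure (UnitAddTorus (Fin 3)))) : UnitAddTorus (Fin 3) → EuclideanSpace ℝ (Fin 3))).toReal)) ∧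
      (∀ μ : Measure (Torus.energySpace (Fin 3)), Torus.IsStationaryStatisticalSolution ν f μ →
        Integrable (fun v : Torus.energySpace (Fin 3) => ‖v‖ ^ 2) μ → Torus.ensembleEnergy μ ≤ E))
    {U : UnitAddTorus (Fin 3) → EuclideanSpace ℝ (Fin 3)}
    (hUs : Torus.IsSmooth U) (hUd : Torus.IsDivFree U) (hUz : Torus.HasZeroMean U)
    (hI : ∀ w : UnitAddTorus (Fin 3) → EuclideanSpace ℝ (Fin 3), Torus.IsSmooth w → Torus.IsDivFree w →
      Torus.HasZeroMean w → ∫ x, ⟪Torus.fderiv w x (U x), U x⟫_ℝ = 0)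
    (hU0 : 0 < ∫ x, ‖U x‖ ^ 2) :
    f ≠ fun x => -Torus.laplacian U x := by
  rintro rfl
  exact xBody_false_of_eulerSteady_laplacianPreimage hUs hUd hUz hI hU0 hX

end Summit.AnomalousDissipation.AnomalousDissipation.Theorems.FloorCertificateEnsembleCeiling.Negative

end
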